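import Summits.HodgeConjecture.CorCM.MumfordTateRankTypeIVThreefoldTimesAnyCurves
import Summits.HodgeConjecture.CorCM.MumfordTateRankBaseTimesMultiplicities
import Literature.AlgebraicGeometry.Motives.AbelianVarietyEndAlgebraIsogenyInvariance
import HarnessLib

/-!
# A simple type-IV(2,1) threefold times ANY elliptic curves (repetitions allowed): `t(T × E₀ × ⋯ × E_m) + 1 + δ = t(T) + t(E₀ × ⋯ × E_m)`,
# `δ = 1` iff some CM curve has its field inside `End⁰T` — so `t = 3a + b + 10 − δ`, `a`, `b` the numbers of non-CM / CM isogeny classes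

COR-CM (cell `pub-hodgecm2`, seat `b27` gen 51, count-neutral Mumford–Tate-rank ladder; theorems only, no definition, no named fact;
UNCONDITIONAL — nothing here uses or asserts HC_CM).  Notation `t(X) = dim MT(H¹X)`; `k = End⁰T`, `t(T) = 10`.

`CorCM/MumfordTateRankTypeIVThreefoldTimesAnyCurves` proves the relative formula for PAIRWISE NON-ISOGENOUS curves.  Here the curves are arbitrary:
regroup them into isogeny classes (`cls : Fin (m+1) → Q`, representatives `R`), replace `T × ⨁_j E_j` by `T × ⨁_j R_{cls j}` (isogeny) and then by
`T × ⨁_q R_q` (`CorCM/MumfordTateRankBaseTimesMultiplicities`: multiplicities over a base do not change `t`), likewise `⨁_j E_j` by `⨁_q R_q`; the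
representatives are pairwise non-isogenous, and the side condition «some CM curve has `End⁰ ↪ k`» is isogeny-invariant (`End⁰` and CM type are).

* **`mtRank_hodge_one_add_one_eq_of_isIsogenous_typeIV_threefold_prod_biproduct_anyCurves_of_isEmpty`** — no CM `E_j` has `End⁰E_j ↪ k`:
  `t(T × ⨁E) + 1 = t(T) + t(⨁E)` — **`Hg(T × E₀ × ⋯ × E_m) = Hg(T) × Hg(E₀ × ⋯ × E_m)` for ALL such families**;
* **`mtRank_hodge_one_add_two_eq_of_isIsogenous_typeIV_threefold_prod_biproduct_anyCurves_of_nonempty`** — some CM `E_{j₀}` has `End⁰E_{j₀} ↪ k`: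
  `t(T × ⨁E) + 2 = t(T) + t(⨁E)`;
* the cells **`t = 3a + b + 10 − δ`** with `a`, `b` the numbers of isogeny classes of non-CM / CM curves (packaged as in `CorCM/MumfordTateRankProductsOfCurves`,
  `t(⨁E) = 3a + b + 1`);
* §4 an absorbed factor keeps `Θ`-rigidity (`hodgeLie_rigid_prod_of_rigid_of_mtRank_le`: `H¹X₁` rigid, `t(X₁ × X₂) ≤ t(X₁)` ⟹ `H¹(X₁ × X₂)` rigid), so
  **`T × E₀ × ⋯ × E_m × E_k` is `Θ`-rigid** and `t(· × Y) ≥ m + 11` for every `Y`.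

## References
* [MoonenZarhin1999LowDim] B. Moonen, Yu. G. Zarhin, *Hodge classes on abelian varieties of low dimension*, Math. Ann. 315 (1999), §1, §3 (3.1), Lemma (3.4),
  (3.6), Prop. (3.8), Thm. 0.1 (4) [corpus: paper:arxiv-math_9901113 pp. 1–2, 6–7]. [cite: MoonenZarhin1999LowDim, §3 (3.4), (3.6) and (3.8)]
* [Gordon1999HodgeAVSurvey] B. B. Gordon, *A survey of the Hodge conjecture for abelian varieties*, §3 Theorem (Imai), 7.5, 7.6.1.
  [cite: Gordon1999HodgeAVSurvey, §3 Theorem (Imai) and 7.6.1]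
* [MumfordAV1970] D. Mumford, *Abelian Varieties* (1970), §19 Thm. 1, Cor. 2, Remark p. 169. [cite: MumfordAV1970, §19 Cor. 2 of Thm. 1]
-/

noncomputable section

open CategoryTheory CategoryTheory.Limits Module
open scoped BigOperators

namespace Summit.HodgeConjecture.CorCM

open Literature.AlgebraicGeometry.Motives
open Literature.AlgebraicGeometry.Motives.AbelianVariety
open Literature.AlgebraicGeometry.Motives.HodgeStructure
open Literature.AlgebraicGeometry.HodgeTheory
open Literature.AlgebraicGeometry.ComplexMultiplication
open Literature.AlgebraicGeometry.Milne1999 (IsOfCMType isOfCMType_iff_of_isIsogenous isIsogeny_biproduct_map)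

variable [HodgeTensorFacts.{0, 0}] {X X' T : AbelianVariety ℂ} {n n' : ℕ} {m : ℕ} {E : Fin (m + 1) → AbelianVariety ℂ}

/-! ## §1 Regrouping a family of curves into pairwise non-isogenous representatives -/

/-- **Isogeny classes of a family of elliptic curves, re-indexed by `Fin`**: representatives `R : Fin (m' + 1) → AV`, pairwise non-isogenous, each some
`E_j`, every `E_j` isogenous to some `R_i`, with `t(A × ⨁E) = t(A × ⨁R)` for every base `A` of positive dimension and `t(⨁E) = t(⨁R)`
(`CorCM/MumfordTateRankBaseTimesMultiplicities`). [cite: MoonenZarhin1999LowDim, §1 and §3] [cite: MumfordAV1970, §19 Thm. 1] -/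
theorem exists_representatives_mtRank_eq_of_curves (hE1 : ∀ j, (E j).dim = 1) :
    ∃ (m' : ℕ) (R : Fin (m' + 1) → AbelianVariety ℂ), (∀ i, ∃ j, R i = E j) ∧ (∀ j, ∃ i, IsIsogenous (E j) (R i)) ∧
      (∀ i i', i ≠ i' → ¬ IsIsogenous (R i) (R i')) ∧
      (∀ {A Y Y' : AbelianVariety ℂ} {l l' : ℕ} (hY : IsSmoothProjective l Y.X) (hY' : IsSmoothProjective l' Y'.X), 0 < A.dim →
        IsIsogenous Y (A.prod (⨁ E)) → IsIsogenous Y' (A.prod (⨁ R)) →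
        haveI := BettiUniverse.finite hY 1
        haveI := BettiUniverse.finite hY' 1
        (BettiUniverse.hodge exists_isReal_hodgeModel_holds hY 1).mtRank = (BettiUniverse.hodge exists_isReal_hodgeModel_holds hY' 1).mtRank) ∧
      (∀ {Y Y' : AbelianVariety ℂ} {l l' : ℕ} (hY : IsSmoothProjective l Y.X) (hY' : IsSmoothProjective l' Y'.X),
        IsIsogenous Y (⨁ E) → IsIsogenous Y' (⨁ R) →
        haveI := BettiUniverse.finite hY 1
        haveI := BettiUniverse.finite hY' 1
        (BettiUniverse.hodge exists_isReal_hodgeModel_holds hY 1).mtRank = (BettiUniverse.hodge exists_isReal_hodgeModel_holds hY' 1).mtRank) := by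
  classical
  -- the isogeny classes of the curves and representatives
  let r : Setoid (Fin (m + 1)) :=
    ⟨fun i j => IsIsogenous (E i) (E j), ⟨fun _ => IsIsogenous.refl _, fun h => h.symm', fun h h' => h.trans h'⟩⟩
  let cls : Fin (m + 1) → Quotient r := Quotient.mk r
  let R : Quotient r → AbelianVariety ℂ := fun c => E c.out
  have hcls : Function.Surjective cls := fun c => ⟨c.out, c.out_eq⟩
  have hrel : ∀ j, IsIsogenous (E j) (R (cls j)) := fun j => by
    have h : r.r (cls j).out j := Quotient.exact (cls j).out_eq
    exact IsIsogenous.symm' h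
  have hniso : ∀ c c', c ≠ c' → ¬ IsIsogenous (R c) (R c') := fun c c' hne h =>
    hne (by rw [← c.out_eq, ← c'.out_eq]; exact Quotient.sound h)
  have hmap : IsIsogenous (⨁ E) (⨁ fun j => R (cls j)) := by
    choose g hg using hrel
    exact ⟨biproduct.map g, isIsogeny_biproduct_map hg⟩
  -- re-index the classes by `Fin (m' + 1)`
  have hcQ : Fintype.card (Quotient r) ≠ 0 := (Fintype.card_pos_iff.2 ⟨cls 0⟩).ne'
  obtain ⟨m', hm'⟩ := Nat.exists_eq_succ_of_ne_zero hcQ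
  let eQ : Fin (m' + 1) ≃ Quotient r := (finCongr hm').symm.trans (Fintype.equivFin (Quotient r)).symm
  let RQ : Fin (m' + 1) → AbelianVariety ℂ := R ∘ eQ
  have hRQ : IsIsogenous (⨁ R) (⨁ RQ) := ⟨(biproduct.reindex eQ R).inv, isIsogeny_hom_of_iso (biproduct.reindex eQ R).symm⟩
  have hR1 : ∀ q, 0 < (R q).dim := fun q => by change 0 < (E _).dim; rw [hE1]; exact one_pos
  refine ⟨m', RQ, fun i => ⟨(eQ i).out, rfl⟩, fun j => ⟨eQ.symm (cls j), ?_⟩,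
    fun i i' hii' => hniso _ _ fun h => hii' (eQ.injective h), ?_, ?_⟩
  · change IsIsogenous (E j) (R (eQ (eQ.symm (cls j))))
    rw [Equiv.apply_symm_apply]
    exact hrel j
  · intro A Y Y' l l' hY hY' hA0 hYP hY'P
    exact mtRank_hodge_one_eq_of_isIsogenous_prod_biproduct_cls R cls hcls hY hY' hA0 (hYP.trans ((IsIsogenous.refl A).prod hmap))
      (hY'P.trans ((IsIsogenous.refl A).prod hRQ.symm'))
  · intro Y Y' l l' hY hY' hYP hY'P
    exact mtRank_hodge_one_eq_of_isIsogenous_biproduct_cls R cls hcls hR1 hY hY' (hYP.trans hmap) (hY'P.trans hRQ.symm')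

/-! ## §2 The relative form for arbitrary curves -/

/-- **`t(T × E₀ × ⋯ × E_m) + 1 = t(T) + t(E₀ × ⋯ × E_m)` — `Hg(T × ⨁E) = Hg(T) × Hg(⨁E)` — for a simple abelian threefold `T` with `dim_ℚ End⁰T = 2`
and ANY elliptic curves `E₀, …, E_m` (repetitions, CM of any field, non-CM) such that no CM curve among them has `End⁰E_j ↪ End⁰T`.**
[cite: MoonenZarhin1999LowDim, §3 (3.4), (3.6) and (3.8)] [cite: Gordon1999HodgeAVSurvey, §3 Theorem (Imai) and 7.6.1] -/
theorem mtRank_hodge_one_add_one_eq_of_isIsogenous_typeIV_threefold_prod_biproduct_anyCurves_of_isEmpty (hX : IsSmoothProjective n X.X)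
    (hX' : IsSmoothProjective n' X'.X) (hTs : T.IsSimple) (hT3 : T.dim = 3) (hTE : Module.finrank ℚ T.endAlgebra = 2)
    (hE1 : ∀ j, (E j).dim = 1) (hfor : ∀ j, IsOfCMType (E j) → IsEmpty ((E j).endAlgebra →+* T.endAlgebra))
    (hXP : IsIsogenous X (T.prod (⨁ E))) (hX'E : IsIsogenous X' (⨁ E)) :
    haveI := BettiUniverse.finite hX 1
    haveI := BettiUniverse.finite hX' 1
    (BettiUniverse.hodge exists_isReal_hodgeModel_holds hX 1).mtRank + 1 =
      10 + (BettiUniverse.hodge exists_isReal_hodgeModel_holds hX' 1).mtRank := by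
  haveI := BettiUniverse.finite hX 1
  haveI := BettiUniverse.finite hX' 1
  obtain ⟨m', R, hRE, -, hRniso, hbase, hfree⟩ := exists_representatives_mtRank_eq_of_curves hE1
  have hY : IsSmoothProjective (T.prod (⨁ R)).dim (T.prod (⨁ R)).X := AbelianVariety.isSmoothProjective_holds
  have hY' : IsSmoothProjective (⨁ R).dim (⨁ R).X := AbelianVariety.isSmoothProjective_holds
  haveI := BettiUniverse.finite hY 1
  haveI := BettiUniverse.finite hY' 1
  have hR1 : ∀ i, (R i).dim = 1 := fun i => by obtain ⟨j, hj⟩ := hRE i; rw [hj, hE1]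
  have hRfor : ∀ i, IsOfCMType (R i) → IsEmpty ((R i).endAlgebra →+* T.endAlgebra) := fun i => by
    obtain ⟨j, hj⟩ := hRE i; rw [hj]; exact hfor j
  have h := mtRank_hodge_one_add_one_eq_of_isIsogenous_typeIV_threefold_prod_biproduct_curves_of_isEmpty hY hY' hTs hT3 hTE hR1 hRniso hRfor
    (IsIsogenous.refl _) (IsIsogenous.refl _)
  rw [hbase hX hY (by omega) hXP (IsIsogenous.refl _), hfree hX' hY' hX'E (IsIsogenous.refl _)]
  exact h

/-- **`t(T × E₀ × ⋯ × E_m) + 2 = t(T) + t(E₀ × ⋯ × E_m)`** for a simple abelian threefold `T` with `dim_ℚ End⁰T = 2`, ANY elliptic curves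
`E₀, …, E_m`, and SOME CM curve `E_{j₀}` with `End⁰E_{j₀} ↪ End⁰T` (its `U(1)` is absorbed in `U(2,1)`; the condition passes to the representative of
its isogeny class, `End⁰` and CM type being isogeny invariants). [cite: MoonenZarhin1999LowDim, Thm. 0.1 (4), §3 (3.4), (3.6) and (3.8)]
[cite: MumfordAV1970, §19 Cor. 2 of Thm. 1] -/
theorem mtRank_hodge_one_add_two_eq_of_isIsogenous_typeIV_threefold_prod_biproduct_anyCurves_of_nonempty (hX : IsSmoothProjective n X.X)
    (hX' : IsSmoothProjective n' X'.X) (hTs : T.IsSimple) (hT3 : T.dim = 3) (hTE : Module.finrank ℚ T.endAlgebra = 2)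
    (hE1 : ∀ j, (E j).dim = 1) {j₀ : Fin (m + 1)} (hj₀cm : IsOfCMType (E j₀)) (hj₀ : Nonempty ((E j₀).endAlgebra →+* T.endAlgebra))
    (hXP : IsIsogenous X (T.prod (⨁ E))) (hX'E : IsIsogenous X' (⨁ E)) :
    haveI := BettiUniverse.finite hX 1
    haveI := BettiUniverse.finite hX' 1
    (BettiUniverse.hodge exists_isReal_hodgeModel_holds hX 1).mtRank + 2 =
      10 + (BettiUniverse.hodge exists_isReal_hodgeModel_holds hX' 1).mtRank := by
  haveI := BettiUniverse.finite hX 1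
  haveI := BettiUniverse.finite hX' 1
  obtain ⟨m', R, hRE, hER, hRniso, hbase, hfree⟩ := exists_representatives_mtRank_eq_of_curves hE1
  have hY : IsSmoothProjective (T.prod (⨁ R)).dim (T.prod (⨁ R)).X := AbelianVariety.isSmoothProjective_holds
  have hY' : IsSmoothProjective (⨁ R).dim (⨁ R).X := AbelianVariety.isSmoothProjective_holds
  haveI := BettiUniverse.finite hY 1
  haveI := BettiUniverse.finite hY' 1
  have hR1 : ∀ i, (R i).dim = 1 := fun i => by obtain ⟨j, hj⟩ := hRE i; rw [hj, hE1]
  -- the representative of the class of `E_{j₀}` is CM with field inside `End⁰T`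
  obtain ⟨i₀, hi₀⟩ := hER j₀
  have hi₀cm : IsOfCMType (R i₀) := (isOfCMType_iff_of_isIsogenous hi₀).1 hj₀cm
  have hi₀for : Nonempty ((R i₀).endAlgebra →+* T.endAlgebra) := by
    obtain ⟨e⟩ := hi₀.symm'.nonempty_endAlgebra_algEquiv
    obtain ⟨f⟩ := hj₀
    exact ⟨f.comp e.toRingEquiv.toRingHom⟩
  have h := mtRank_hodge_one_add_two_eq_of_isIsogenous_typeIV_threefold_prod_biproduct_curves_of_nonempty hY hY' hTs hT3 hTE hR1 hRniso hi₀cm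
    hi₀for (IsIsogenous.refl _) (IsIsogenous.refl _)
  rw [hbase hX hY (by omega) hXP (IsIsogenous.refl _), hfree hX' hY' hX'E (IsIsogenous.refl _)]
  exact h

/-! ## §3 The cells `t = 3a + b + 10 − δ` with `a`, `b` the numbers of isogeny classes -/

/-- **`t(T × E₀ × ⋯ × E_m) = 3a + b + 10`** for ANY elliptic curves none of whose CM fields lies in `End⁰T` — `a`, `b` the numbers of isogeny classes
of non-CM / CM curves among them (`Hg = U(2,1) × SL₂^a × U(1)^b`). [cite: MoonenZarhin1999LowDim, §3 (3.4), (3.6) and (3.8)]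
[cite: Gordon1999HodgeAVSurvey, §3 Theorem (Imai) and 7.6.1] -/
theorem exists_mtRank_hodge_one_eq_of_isIsogenous_typeIV_threefold_prod_biproduct_anyCurves_of_isEmpty (hX : IsSmoothProjective n X.X)
    (hTs : T.IsSimple) (hT3 : T.dim = 3) (hTE : Module.finrank ℚ T.endAlgebra = 2) (hE1 : ∀ j, (E j).dim = 1)
    (hfor : ∀ j, IsOfCMType (E j) → IsEmpty ((E j).endAlgebra →+* T.endAlgebra)) (hXP : IsIsogenous X (T.prod (⨁ E))) :
    haveI := BettiUniverse.finite hX 1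
    ∃ a b : ℕ, 1 ≤ a + b ∧ a + b ≤ m + 1 ∧ (BettiUniverse.hodge exists_isReal_hodgeModel_holds hX 1).mtRank = 3 * a + b + 10 ∧
      (a = 0 ↔ ∀ j, IsOfCMType (E j)) ∧ (b = 0 ↔ ∀ j, ¬ IsOfCMType (E j)) := by
  haveI := BettiUniverse.finite hX 1
  have hY : IsSmoothProjective (⨁ E).dim (⨁ E).X := AbelianVariety.isSmoothProjective_holds
  haveI := BettiUniverse.finite hY 1
  have h := mtRank_hodge_one_add_one_eq_of_isIsogenous_typeIV_threefold_prod_biproduct_anyCurves_of_isEmpty hX hY hTs hT3 hTE hE1 hfor hXP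
    (IsIsogenous.refl _)
  obtain ⟨a, b, h1, hm, ht, ha, hb⟩ := exists_mtRank_hodge_one_eq_of_biproduct_curves hY hE1 (IsIsogenous.refl _)
  exact ⟨a, b, h1, hm, by omega, ha, hb⟩

/-- **`t(T × E₀ × ⋯ × E_m) = 3a + b + 9`** for ANY elliptic curves among which SOME CM curve has its field inside `End⁰T` — `a`, `b ≥ 1` the numbers
of isogeny classes of non-CM / CM curves (`Hg = U(2,1) × SL₂^a × U(1)^{b−1}`). [cite: MoonenZarhin1999LowDim, Thm. 0.1 (4), §3 (3.4), (3.6) and (3.8)] -/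
theorem exists_mtRank_hodge_one_eq_of_isIsogenous_typeIV_threefold_prod_biproduct_anyCurves_of_nonempty (hX : IsSmoothProjective n X.X)
    (hTs : T.IsSimple) (hT3 : T.dim = 3) (hTE : Module.finrank ℚ T.endAlgebra = 2) (hE1 : ∀ j, (E j).dim = 1)
    {j₀ : Fin (m + 1)} (hj₀cm : IsOfCMType (E j₀)) (hj₀ : Nonempty ((E j₀).endAlgebra →+* T.endAlgebra)) (hXP : IsIsogenous X (T.prod (⨁ E))) :
    haveI := BettiUniverse.finite hX 1
    ∃ a b : ℕ, 1 ≤ b ∧ a + b ≤ m + 1 ∧ (BettiUniverse.hodge exists_isReal_hodgeModel_holds hX 1).mtRank = 3 * a + b + 9 ∧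
      (a = 0 ↔ ∀ j, IsOfCMType (E j)) := by
  haveI := BettiUniverse.finite hX 1
  have hY : IsSmoothProjective (⨁ E).dim (⨁ E).X := AbelianVariety.isSmoothProjective_holds
  haveI := BettiUniverse.finite hY 1
  have h := mtRank_hodge_one_add_two_eq_of_isIsogenous_typeIV_threefold_prod_biproduct_anyCurves_of_nonempty hX hY hTs hT3 hTE hE1 hj₀cm hj₀
    hXP (IsIsogenous.refl _)
  obtain ⟨a, b, h1, hm, ht, ha, hb⟩ := exists_mtRank_hodge_one_eq_of_biproduct_curves hY hE1 (IsIsogenous.refl _)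
  have hb1 : 1 ≤ b := by
    rcases Nat.eq_zero_or_pos b with hb0 | hb0
    · exact absurd hj₀cm (hb.1 hb0 j₀)
    · exact hb0
  exact ⟨a, b, hb1, hm, by omega, ha⟩

/-! ## §4 The absorbed curve keeps `Θ`-rigidity: `T × E₀ × ⋯ × E_m × E_k` is `Θ`-rigid, `t(· × Y) ≥ m + 11` -/

/-- **An absorbed factor keeps `Θ`-rigidity**: if `H¹X₁` is `Θ`-rigid and `t(X₁ × X₂) ≤ t(X₁)` (so `Lie Hg(H¹(X₁ × X₂)) ≅ Lie Hg(H¹X₁)` by the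
restriction, `Hg(X₁ × X₂) ≅ Hg(X₁)`), then `H¹(X₁ × X₂)` is `Θ`-rigid (`Motives/HodgeLieTimesCMSummandRigid` §2 on the bicone of `H¹(X₁ × X₂)`).
[cite: MoonenZarhin1999LowDim, §3 (3.1)] [cite: Deligne1982HodgeCycles, I §3.1 and Prop. 3.4] -/
theorem hodgeLie_rigid_prod_of_rigid_of_mtRank_le {X₁ X₂ : AbelianVariety ℂ} {n₁ l : ℕ} (hX₁ : IsSmoothProjective n₁ X₁.X)
    (hP : IsSmoothProjective l (X₁.prod X₂).X) (h₁ : 0 < X₁.dim)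
    (hrig₁ : haveI := BettiUniverse.finite hX₁ 1
      ∀ 𝔞 : Submodule ℚ (Module.End ℚ (bettiCohomology X₁.X 1)),
        𝔞 ≤ (BettiUniverse.hodge exists_isReal_hodgeModel_holds hX₁ 1).hodgeLie →
        (∀ B ∈ 𝔞, ∀ B' ∈ 𝔞, B * B' - B' * B ∈ 𝔞) →
        (∃ Θ ∈ Submodule.span ℂ ((fun B : Module.End ℚ (bettiCohomology X₁.X 1) => B.baseChange ℂ) ''
            (𝔞 : Set (Module.End ℚ (bettiCohomology X₁.X 1)))),
          ∀ p, ∀ x ∈ (BettiUniverse.hodge exists_isReal_hodgeModel_holds hX₁ 1).piece p (((1 : ℕ) : ℤ) - p),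
            Θ x = ((2 * p - ((1 : ℕ) : ℤ) : ℤ) : ℂ) • x) →
        (BettiUniverse.hodge exists_isReal_hodgeModel_holds hX₁ 1).hodgeLie ≤ 𝔞)
    (hle : haveI := BettiUniverse.finite hX₁ 1
      haveI := BettiUniverse.finite hP 1
      (BettiUniverse.hodge exists_isReal_hodgeModel_holds hP 1).mtRank ≤ (BettiUniverse.hodge exists_isReal_hodgeModel_holds hX₁ 1).mtRank) :
    haveI := BettiUniverse.finite hP 1
    ∀ 𝔞 : Submodule ℚ (Module.End ℚ (bettiCohomology (X₁.prod X₂).X 1)),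
      𝔞 ≤ (BettiUniverse.hodge exists_isReal_hodgeModel_holds hP 1).hodgeLie →
      (∀ B ∈ 𝔞, ∀ B' ∈ 𝔞, B * B' - B' * B ∈ 𝔞) →
      (∃ Θ ∈ Submodule.span ℂ ((fun B : Module.End ℚ (bettiCohomology (X₁.prod X₂).X 1) => B.baseChange ℂ) ''
          (𝔞 : Set (Module.End ℚ (bettiCohomology (X₁.prod X₂).X 1)))),
        ∀ p, ∀ x ∈ (BettiUniverse.hodge exists_isReal_hodgeModel_holds hP 1).piece p (((1 : ℕ) : ℤ) - p),
          Θ x = ((2 * p - ((1 : ℕ) : ℤ) : ℤ) : ℂ) • x) →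
      (BettiUniverse.hodge exists_isReal_hodgeModel_holds hP 1).hodgeLie ≤ 𝔞 := by
  have hn : X₁.dim = n₁ := schemeDim_eq_holds hX₁
  subst hn
  haveI := BettiUniverse.finite hX₁ 1
  haveI := BettiUniverse.finite hP 1
  let ι₁ := BettiUniverse.pullHodgeHom exists_isReal_hodgeModel_holds hodgePQ_independent_of_hodgeModel_holds hP hX₁ (fst X₁ X₂).hom.hom.hom 1
  let π₁ := BettiUniverse.pullHodgeHom exists_isReal_hodgeModel_holds hodgePQ_independent_of_hodgeModel_holds hX₁ hP
    (prodLift (𝟙 X₁) (0 : X₁ ⟶ X₂)).hom.hom.hom 1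
  have hπι₁ : ∀ v, π₁.toLinearMap (ι₁.toLinearMap v) = v := fun v => pull_pull_eq_self_of_comp_eq_id (prodLift_fst _ _) v
  have hP0 : 0 < (X₁.prod X₂).dim := by rw [dim_prod]; omega
  have hfin : Module.finrank ℚ (BettiUniverse.hodge exists_isReal_hodgeModel_holds hP 1).hodgeLie ≤
      Module.finrank ℚ (BettiUniverse.hodge exists_isReal_hodgeModel_holds hX₁ 1).hodgeLie := by
    have h := hle
    rw [mtRank_hodge_one_eq_finrank_hodgeLie_add_one hP hP0, mtRank_hodge_one_eq_finrank_hodgeLie_add_one hX₁ h₁] at h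
    omega
  exact rigid_of_rigid_of_finrank_le ι₁ π₁ hπι₁ hrig₁ hfin

/-- **`H¹(T × E₀ × ⋯ × E_m × E)` is `Θ`-rigid** for a simple abelian threefold `T` with `dim_ℚ End⁰T = 2`, pairwise non-isogenous CM curves `E_j` with
`End⁰E_j ↛ End⁰T`, and a CM curve `E` with `End⁰E ↪ End⁰T`: the factor `E` is absorbed (`t = m + 11` on both sides,
`CorCM/MumfordTateRankCMCurvesTowerRigid` §4) and `H¹(T × ⨁E)` is `Θ`-rigid (ibid. §2). Hence **`m + 11 ≤ t(Z)` for every `Z ∼ (T × ⨁E × E) × Y`**.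
[cite: MoonenZarhin1999LowDim, Thm. 0.1 (4), §3 (3.1), (3.6) and (3.8)] -/
theorem hodgeLie_rigid_and_le_mtRank_of_threefold_prod_biproduct_cmCurves_prod_sameField {C : AbelianVariety ℂ} {l : ℕ}
    (hP : IsSmoothProjective l ((T.prod (⨁ E)).prod C).X) (hTs : T.IsSimple) (hT3 : T.dim = 3) (hTE : Module.finrank ℚ T.endAlgebra = 2)
    (hE1 : ∀ j, (E j).dim = 1) (hEcm : ∀ j, IsOfCMType (E j)) (hniso : ∀ i j, i ≠ j → ¬ IsIsogenous (E i) (E j))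
    (hfor : ∀ j, IsEmpty ((E j).endAlgebra →+* T.endAlgebra)) (hC1 : C.dim = 1) (hCcm : IsOfCMType C)
    (hCfor : Nonempty (C.endAlgebra →+* T.endAlgebra)) :
    haveI := BettiUniverse.finite hP 1
    (∀ 𝔞 : Submodule ℚ (Module.End ℚ (bettiCohomology ((T.prod (⨁ E)).prod C).X 1)),
      𝔞 ≤ (BettiUniverse.hodge exists_isReal_hodgeModel_holds hP 1).hodgeLie →
      (∀ B ∈ 𝔞, ∀ B' ∈ 𝔞, B * B' - B' * B ∈ 𝔞) →
      (∃ Θ ∈ Submodule.span ℂ ((fun B : Module.End ℚ (bettiCohomology ((T.prod (⨁ E)).prod C).X 1) => B.baseChange ℂ) ''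
          (𝔞 : Set (Module.End ℚ (bettiCohomology ((T.prod (⨁ E)).prod C).X 1)))),
        ∀ p, ∀ x ∈ (BettiUniverse.hodge exists_isReal_hodgeModel_holds hP 1).piece p (((1 : ℕ) : ℤ) - p),
          Θ x = ((2 * p - ((1 : ℕ) : ℤ) : ℤ) : ℂ) • x) →
      (BettiUniverse.hodge exists_isReal_hodgeModel_holds hP 1).hodgeLie ≤ 𝔞) ∧
    ∀ {Z : AbelianVariety ℂ} {nZ : ℕ} (hZ : IsSmoothProjective nZ Z.X) {Y : AbelianVariety ℂ}, IsIsogenous Z (((T.prod (⨁ E)).prod C).prod Y) →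
      haveI := BettiUniverse.finite hZ 1
      m + 11 ≤ (BettiUniverse.hodge exists_isReal_hodgeModel_holds hZ 1).mtRank := by
  haveI := BettiUniverse.finite hP 1
  have hA : IsSmoothProjective (T.prod (⨁ E)).dim (T.prod (⨁ E)).X := AbelianVariety.isSmoothProjective_holds
  haveI := BettiUniverse.finite hA 1
  have h11 := mtRank_hodge_one_eq_of_isIsogenous_threefold_prod_biproduct_cmCurves_prod_sameField hP hTs hT3 hTE hE1 hEcm hniso hfor hC1 hCcm hCfor
    (IsIsogenous.refl _)
  have h11' := mtRank_hodge_one_eq_of_isIsogenous_typeIV_threefold_prod_biproduct_cmCurves hA hTs hT3 hTE hE1 hEcm hniso hfor (IsIsogenous.refl _)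
  have hrig := hodgeLie_rigid_prod_of_rigid_of_mtRank_le hA hP (by rw [dim_prod]; omega)
    (hodgeLie_rigid_isSimple_threefold_prod_biproduct_cmCurves hA hTs hT3 hTE hE1 hEcm hniso hfor) (by rw [h11, h11'])
  refine ⟨hrig, fun hZ Y hZP => ?_⟩
  have h := mtRank_hodge_one_le_of_isIsogenous_prod_of_rigid hZ hP (by rw [dim_prod, dim_prod]; omega) hrig hZP
  rw [h11] at h
  exact h

end Summit.HodgeConjecture.CorCM

end
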